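import Literature.AlgebraicGeometry.Limits.LocalizationSchemeDescent       -- ★ `LocApprox.exists_iso_pullback` (Stacks 01ZM for a localisation)
import Literature.AlgebraicGeometry.Limits.LocalizationSeparatedSpread    -- ★ `LocApprox.exists_forall_isSeparated_snd` (EGA IV₃ 8.10.5 (v))
import Literature.AlgebraicGeometry.Morphisms.GenericFlatness             -- ★ `Morphisms.exists_flat_morphismRestrict_basicOpen` (GW Thm. 10.84)
import Literature.AlgebraicGeometry.Motives.IntegralModelOfGlobalModel    -- ★ `IntegralModel.localiseAt` (models along a tower `A → R → K`)
import Mathlib.AlgebraicGeometry.Morphisms.Flat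
import Mathlib.AlgebraicGeometry.Noetherian
import Mathlib.RingTheory.Localization.Away.Basic
import Mathlib.RingTheory.Flat.Localization
import Mathlib.RingTheory.Localization.LocalizationLocalization
import Mathlib.NumberTheory.NumberField.Basic
import HarnessLib

/-!
# A flat, finitely presented model of `X ⊗_F Fᵢ` over an intermediate ring `𝓞 Fᵢ ⊆ 𝓞 Fᵢ[1∕t] ⊆ Fᵢ`

Topic `Literature/AlgebraicGeometry/Limits`; namespace `Literature.AlgebraicGeometry.Limits`.  THEOREMS ONLY (no definition, no named fact, no instance,
no notation, no `sorry`).  Cell `hodgecm-mathlib`, FLOOR 0, P6 «MOD programme» (crux hLiu418 = stmt-HodgeConjecture-24832, `--supports`), line «L4» ∕ GEN: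
the (O-MODEL) organ of GEN՚s assembly `gen_of_parts` (A-p18 (g32) 2026-09-02T05:25:02Z (vii); «L4» LA4-plan (g0) DEAL #21): GEN՚s letter
`RecordGENChoicesCofinal` binds an integral model `𝓜` of the thickened record curve with structure map quasi-compact, quasi-separated, locally of
finite presentation, FLAT and separated; it is obtained from ANY flat finitely presented model over an intermediate ring `𝓞 Fᵢ ⊆ B ⊆ Fᵢ` by ★
`IntegralModel.restrictScalarsOfIntermediate` (`Motives/IntegralModelRestrictScalarsAway`).  This file produces such a model for every
quasi-compact separated `F`-scheme of finite type, with `B := 𝓞 Fᵢ[1∕t]`: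

* §1 `flat_pullback_snd_specMap_of_flat_morphismRestrict_basicOpen` — if `f : X → Spec A` is flat over the basic open `D(a)`, then
  `X ×_A Spec A[1∕t] → Spec A[1∕t]` is flat for every multiple `t` of `a` (`Spec A[1∕t] → Spec A` factors through `D(a)`; flatness is stable under
  base change — Mathlib `isPullback_morphismRestrict`, `IsOpenImmersion.lift`, `IsPullback.of_right`, `MorphismProperty.of_isPullback`).
* §2 **`exists_model_forall_away_isSeparated_flat`** — `A` a Noetherian domain, `K = Frac A`, `X → Spec K` quasi-compact separated of finite type:
  an `A`-model `P` (qc, qs, lfp, `P ⊗_A K ≅ X`) and `t₀ ≠ 0` with `P ⊗_A A[1∕t] → Spec A[1∕t]` SEPARATED and FLAT for every multiple `t` of `t₀`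
  (★ `LocApprox.exists_iso_pullback` = Stacks 01ZM for the localisation `K` of `A`; ★ `LocApprox.exists_forall_isSeparated_snd` = EGA IV₃ 8.10.5 (v);
  ★ `Morphisms.exists_flat_morphismRestrict_basicOpen` = generic flatness GW Thm. 10.84 ∕ EGA IV₂ 6.9.1; §1).
* §3 **`exists_intermediateModel`** — number fields `F ⊆ Fᵢ`, `X` an `F`-scheme (qc, separated, finite type): `B := 𝓞 Fᵢ[1∕t]` with its
  algebra structures (`B → Fᵢ` the localisation lift, injective since `Fᵢ = Frac B`; `B` flat and finitely presented over `𝓞 Fᵢ` — Mathlib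
  `IsLocalization.flat`, `IsLocalization.Away.finitePresentation`; `𝓞 F`-algebra through `𝓞 F → 𝓞 Fᵢ`, Mathlib՚s localisation instance, all towers)
  and `𝓜 := ★ IntegralModel.localiseAt ⟨P, e⟩ B : IntegralModel B Fᵢ (X ⊗_F Fᵢ)` with `𝓜.total → Spec B` qc, qs, separated, flat, lfp — GEN՚s proposed
  signature TOKEN FOR TOKEN.
Budgets: default heartbeats; the two programme `set_option`s only.

References: [EGAIV3] A. Grothendieck, EGA IV₃, Publ. Math. IHÉS 28 (1966), Thm. 8.8.2 (ii), Thm. 8.10.5 (v); [EGAIV2] EGA IV₂, Publ. Math. IHÉS 24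
(1965), Thm. 6.9.1; [GortzWedhorn2020] U. Görtz, T. Wedhorn, *Algebraic Geometry I* (2nd ed.), Thm. 10.66, Thm. 10.84 ∕ Cor. 10.85; [StacksProject]
Tags 01ZM, 01U9; [SerreTate1968] J.-P. Serre, J. Tate, *Good reduction of abelian varieties*, Ann. of Math. 88 (1968), §1.
HC_CM is proved only modulo the printed citations (2 remaining named inputs hLiu418 24832, h413 24833) until rung 0 closes — count-neutral.
-/

set_option autoImplicit false

noncomputable section

set_option backward.isDefEq.respectTransparency false

universe u

open CategoryTheory CategoryTheory.Limits AlgebraicGeometry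
open scoped NumberField nonZeroDivisors

namespace Literature.AlgebraicGeometry.Limits

open Literature.AlgebraicGeometry.Motives (SchemeOver specOver baseChange IntegralModel)

/-! ## §1 Flatness over `Spec A[1∕t]` from flatness over a basic open `D(a) ⊇ D(t)` -/

/-- **Flat over `D(a)` ⇒ flat after base change to `A[1∕t]` for `a ∣ t`**: if `f : X → Spec A` restricted to the basic open `D(a)` is flat,
then for every multiple `t` of `a` and every localisation `T` of `A` away from `t` the base change `X ×_A Spec T → Spec T` is flat
(`Spec T → Spec A` has image `D(t) ⊆ D(a)`, so it factors through the open immersion `D(a) ↪ Spec A`, and the base change along it is a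
base change of the flat `f|_{D(a)}`; flatness is stable under base change). [cite: StacksProject, Tag 01U9 (base change of a flat morphism is flat)] -/
theorem flat_pullback_snd_specMap_of_flat_morphismRestrict_basicOpen {A : Type u} [CommRing A] {X : Scheme.{u}}
    (f : X ⟶ Spec (.of A)) (a : A) (h : Flat (f ∣_ (Spec (.of A)).basicOpen ((Scheme.ΓSpecIso (.of A)).inv a)))
    (t : A) (hat : a ∣ t) (T : Type u) [CommRing T] [Algebra A T] [IsLocalization.Away t T] :
    Flat (pullback.snd f (Spec.map (CommRingCat.ofHom (algebraMap A T)))) := by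
  set U : (Spec (.of A)).Opens := (Spec (.of A)).basicOpen ((Scheme.ΓSpecIso (.of A)).inv a) with hU
  set ι : Spec (.of T) ⟶ Spec (.of A) := Spec.map (CommRingCat.ofHom (algebraMap A T)) with hι
  -- the image of `Spec A[1∕t] → Spec A` is `D(t) ⊆ D(a) = U`
  have hrange : Set.range ι ⊆ Set.range U.ι := by
    rw [Scheme.Opens.range_ι, hU, basicOpen_eq_of_affine]
    obtain ⟨c, rfl⟩ := hat
    rintro _ ⟨x, rfl⟩
    have hx : ι x ∈ (PrimeSpectrum.basicOpen (a * c) : Set (PrimeSpectrum A)) := by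
      rw [← PrimeSpectrum.localization_away_comap_range T (a * c)]
      exact ⟨x, rfl⟩
    exact PrimeSpectrum.basicOpen_mul_le_left a c hx
  let g : Spec (.of T) ⟶ (U : Scheme.{u}) := IsOpenImmersion.lift U.ι ι hrange
  have hg : g ≫ U.ι = ι := IsOpenImmersion.lift_fac _ _ _
  -- pasting: `X ×_A Spec T → Spec T` is a base change of `f|_U : f⁻¹ U → U` along `g`
  have sqU : IsPullback (f ⁻¹ᵁ U).ι (f ∣_ U) f U.ι := (isPullback_morphismRestrict f U).flip
  have sq : IsPullback (pullback.fst f ι) (pullback.snd f ι) f ι := IsPullback.of_hasPullback f ι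
  have w : pullback.fst f ι ≫ f = (pullback.snd f ι ≫ g) ≫ U.ι := by
    rw [Category.assoc, hg, pullback.condition]
  have sq' : IsPullback (sqU.lift (pullback.fst f ι) (pullback.snd f ι ≫ g) w ≫ (f ⁻¹ᵁ U).ι)
      (pullback.snd f ι) f (g ≫ U.ι) := by
    rw [IsPullback.lift_fst, hg]
    exact sq
  have sq'' : IsPullback (sqU.lift (pullback.fst f ι) (pullback.snd f ι ≫ g) w) (pullback.snd f ι) (f ∣_ U) g :=
    IsPullback.of_right sq' (IsPullback.lift_snd _ _ _ _) sqU
  exact MorphismProperty.of_isPullback (P := @Flat) sq'' h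


/-! ## §2 A model over a Noetherian domain whose localisations away from one element are separated and flat -/

/-- **Spreading out a separated scheme of finite type over `K = Frac A` to a model over `A`, separated and flat away from one
nonzero element** (`A` a Noetherian domain): for `X → Spec K` quasi-compact, separated, of finite type there are an `A`-scheme `P`
(quasi-compact, quasi-separated, locally of finite presentation) with `P ⊗_A K ≅ X` over `K` and `t₀ ≠ 0` in `A` such that for every
multiple `t` of `t₀` and every localisation `T` of `A` away from `t`, `P ⊗_A T → Spec T` is separated and flat.  Proof: `P` by EGA IV₃
8.8.2 (ii) ∕ Stacks 01ZM for the localisation `K = A_{(0)}` (★ `LocApprox.exists_iso_pullback`); separatedness of the generic fibre spreads to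
all small `D(t)` (EGA IV₃ 8.10.5 (v), ★ `LocApprox.exists_forall_isSeparated_snd`); generic flatness (GW Thm. 10.84 ∕ EGA IV₂ 6.9.1,
★ `Morphisms.exists_flat_morphismRestrict_basicOpen`) gives `a ≠ 0` with `P|_{D(a)}` flat; `t₀ := s · a`.
[cite: EGAIV3, Thm. 8.8.2 (ii) and Thm. 8.10.5 (v)] [cite: GortzWedhorn2020, Thm. 10.84 and Cor. 10.85 (generic flatness)] -/
theorem exists_model_forall_away_isSeparated_flat {A K : Type u} [CommRing A] [IsDomain A] [IsNoetherianRing A]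
    [Field K] [Algebra A K] [IsFractionRing A K] (X : SchemeOver K)
    [QuasiCompact X.hom] [IsSeparated X.hom] [LocallyOfFiniteType X.hom] :
    ∃ (P : SchemeOver A) (_ : (baseChange A K).obj P ≅ X) (t₀ : A), t₀ ≠ 0 ∧
      QuasiCompact P.hom ∧ QuasiSeparated P.hom ∧ LocallyOfFinitePresentation P.hom ∧
      ∀ t : A, t₀ ∣ t → ∀ (T : Type u) [CommRing T] [Algebra A T] [IsLocalization.Away t T],
        IsSeparated (pullback.snd P.hom (Spec.map (CommRingCat.ofHom (algebraMap A T)))) ∧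
        Flat (pullback.snd P.hom (Spec.map (CommRingCat.ofHom (algebraMap A T)))) := by
  classical
  -- over the Noetherian `Spec K`, finite type = finite presentation; separated ⇒ quasi-separated
  haveI : IsLocallyNoetherian (Spec (CommRingCat.of K)) := (isLocallyNoetherian_Spec (R := .of K)).mpr inferInstance
  haveI : LocallyOfFinitePresentation X.hom := LocallyOfFinitePresentation.iff_locallyOfFiniteType.mpr ‹_›
  -- Step 1: a model over `A` (Stacks 01ZM for the localisation `K` of `A`)
  obtain ⟨P, hqc, hqs, hlfp, ⟨e⟩⟩ := LocApprox.exists_iso_pullback (A⁰) X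
  haveI := hqc
  haveI := hqs
  haveI := hlfp
  -- Step 2: separatedness of the generic fibre spreads to every small `D(t)`
  have hsepK : IsSeparated (pullback.snd P.hom (Spec.map (CommRingCat.ofHom (algebraMap A K)))) := by
    haveI : IsIso e.hom.left := (inferInstance : IsIso ((Over.forget _).mapIso e).hom)
    have hw : e.hom.left ≫ X.hom = pullback.snd P.hom (Spec.map (CommRingCat.ofHom (algebraMap A K))) := Over.w e.hom
    rw [← hw]
    exact (MorphismProperty.cancel_left_of_respectsIso (@IsSeparated) e.hom.left X.hom).mpr ‹_›
  obtain ⟨s₁, hs₁, hsep⟩ := LocApprox.exists_forall_isSeparated_snd (A⁰) K P hsepK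
  -- Step 3: generic flatness over the integral Noetherian `Spec A`
  haveI : IsNoetherianRing (CommRingCat.of A) := ‹IsNoetherianRing A›
  haveI : IsLocallyNoetherian (Spec (CommRingCat.of A)) := (isLocallyNoetherian_Spec (R := .of A)).mpr ‹_›
  haveI : IsDomain (CommRingCat.of A) := ‹IsDomain A›
  have hne : ((⊤ : (Spec (CommRingCat.of A)).Opens) : Set (Spec (CommRingCat.of A))).Nonempty := by
    simp only [TopologicalSpace.Opens.coe_top]
    exact Set.univ_nonempty
  obtain ⟨s, hs0, hflat⟩ :=
    Morphisms.exists_flat_morphismRestrict_basicOpen P.hom (isAffineOpen_top (Spec (.of A))) hne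
  set a : A := (Scheme.ΓSpecIso (.of A)).hom s with ha
  have hsa : (Scheme.ΓSpecIso (.of A)).inv a = s := Iso.hom_inv_id_apply _ _
  have ha0 : a ≠ 0 := fun h0 => hs0 (by rw [← hsa, h0, map_zero])
  rw [← hsa] at hflat
  refine ⟨P, e, (s₁ : A) * a, mul_ne_zero (nonZeroDivisors.ne_zero hs₁) ha0, hqc, hqs, hlfp, fun t ht T _ _ _ => ⟨?_, ?_⟩⟩
  · exact hsep t ((dvd_mul_right _ _).trans ht) T
  · exact flat_pullback_snd_specMap_of_flat_morphismRestrict_basicOpen P.hom a hflat t ((dvd_mul_left _ _).trans ht) T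


/-! ## §3 Number fields: a flat finitely presented model of `X ⊗_F Fᵢ` over `𝓞 Fᵢ[1∕t]` -/

/-- **A FLAT FINITE-PRESENTATION MODEL OF `X ⊗_F Fᵢ` OVER AN INTERMEDIATE RING `𝓞 Fᵢ ⊆ B ⊆ Fᵢ`** (the (O-MODEL) organ of GEN՚s
`gen_of_parts`, A-p18 (g32) 2026-09-02T05:25:02Z (vii), statement token for token): for number fields `F ⊆ Fᵢ` and an `F`-scheme `X`
(quasi-compact, separated, of finite type) there are `B := 𝓞 Fᵢ[1∕t]` (`t ≠ 0`; a flat, finitely presented `𝓞 Fᵢ`-algebra, an `𝓞 F`-algebra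
through `𝓞 F → 𝓞 Fᵢ`, with `B → Fᵢ` injective and all scalar towers) and an integral model `𝓜` of `X ⊗_F Fᵢ` over `B` whose structure map
`𝓜.total → Spec B` is quasi-compact, quasi-separated, separated, FLAT and locally of finite presentation (§2 at `A := 𝓞 Fᵢ`, `K := Fᵢ`,
then ★ `IntegralModel.localiseAt` along `𝓞 Fᵢ → B → Fᵢ`).  The five binders of the GEN letter for the restricted model over `𝓞 F` then
follow from ★ `quasiCompact_∕quasiSeparated_∕isSeparated_∕flat_∕locallyOfFinitePresentation_restrictScalarsOfIntermediate`.
[cite: EGAIV3, Thm. 8.8.2 (ii) and Thm. 8.10.5 (v)] [cite: GortzWedhorn2020, Thm. 10.84 (generic flatness)] [cite: SerreTate1968, §1 (models over rings of `S`-integers)] -/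
theorem exists_intermediateModel (F : Type) [Field F] [NumberField F] (Fi : Type) [Field Fi] [NumberField Fi] [Algebra F Fi]
    (X : SchemeOver F) [QuasiCompact X.hom] [IsSeparated X.hom] [LocallyOfFiniteType X.hom] :
    ∃ (B : Type) (_ : CommRing B) (_ : Algebra (𝓞 Fi) B) (_ : Algebra B Fi) (_ : IsScalarTower (𝓞 Fi) B Fi)
      (_ : Algebra (𝓞 F) B) (_ : IsScalarTower (𝓞 F) B Fi) (_ : IsScalarTower (𝓞 F) (𝓞 Fi) B)
      (_ : Module.Flat (𝓞 Fi) B) (_ : Algebra.FinitePresentation (𝓞 Fi) B)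
      (𝓜 : IntegralModel B Fi ((baseChange F Fi).obj X)),
      Function.Injective (algebraMap B Fi) ∧ QuasiCompact 𝓜.total.hom ∧ QuasiSeparated 𝓜.total.hom ∧
        IsSeparated 𝓜.total.hom ∧ Flat 𝓜.total.hom ∧ LocallyOfFinitePresentation 𝓜.total.hom := by
  classical
  -- the generic fibre `X ⊗_F Fᵢ → Spec Fᵢ` is quasi-compact, separated, of finite type (base change)
  haveI : QuasiCompact ((baseChange F Fi).obj X).hom :=
    inferInstanceAs (QuasiCompact (pullback.snd X.hom (Spec.map (CommRingCat.ofHom (algebraMap F Fi)))))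
  haveI : IsSeparated ((baseChange F Fi).obj X).hom :=
    inferInstanceAs (IsSeparated (pullback.snd X.hom (Spec.map (CommRingCat.ofHom (algebraMap F Fi)))))
  haveI : LocallyOfFiniteType ((baseChange F Fi).obj X).hom :=
    inferInstanceAs (LocallyOfFiniteType (pullback.snd X.hom (Spec.map (CommRingCat.ofHom (algebraMap F Fi)))))
  -- §2 over the Noetherian domain `𝓞 Fᵢ` with fraction field `Fᵢ`
  obtain ⟨P, e, t₀, ht₀, hqc, hqs, hlfp, hgood⟩ :=
    exists_model_forall_away_isSeparated_flat (A := 𝓞 Fi) (K := Fi) ((baseChange F Fi).obj X)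
  haveI := hqc
  haveI := hqs
  haveI := hlfp
  -- the intermediate ring `B := 𝓞 Fᵢ[1∕t₀]` and its map to `Fᵢ`
  have ht₀u : IsUnit (algebraMap (𝓞 Fi) Fi t₀) :=
    (IsUnit.mk0 _ ((map_ne_zero_iff _ (FaithfulSMul.algebraMap_injective (𝓞 Fi) Fi)).mpr ht₀))
  letI algBFi : Algebra (Localization.Away t₀) Fi := (IsLocalization.Away.lift t₀ ht₀u).toAlgebra
  have halg : ∀ b : Localization.Away t₀, algebraMap (Localization.Away t₀) Fi b = IsLocalization.Away.lift t₀ ht₀u b :=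
    fun _ => rfl
  haveI towBFi : IsScalarTower (𝓞 Fi) (Localization.Away t₀) Fi :=
    IsScalarTower.of_algebraMap_eq fun x => by rw [halg, IsLocalization.Away.lift_eq]
  haveI towFAB : IsScalarTower (𝓞 F) (𝓞 Fi) (Localization.Away t₀) := inferInstance
  haveI towFBFi : IsScalarTower (𝓞 F) (Localization.Away t₀) Fi :=
    IsScalarTower.of_algebraMap_eq fun x => by
      rw [IsScalarTower.algebraMap_apply (𝓞 F) (𝓞 Fi) (Localization.Away t₀), ← IsScalarTower.algebraMap_apply (𝓞 Fi),
        ← IsScalarTower.algebraMap_apply]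
  haveI hflatB : Module.Flat (𝓞 Fi) (Localization.Away t₀) := IsLocalization.flat (Localization.Away t₀) (Submonoid.powers t₀)
  haveI hfpB : Algebra.FinitePresentation (𝓞 Fi) (Localization.Away t₀) := IsLocalization.Away.finitePresentation t₀
  haveI : IsFractionRing (Localization.Away t₀) Fi :=
    IsFractionRing.isFractionRing_of_isDomain_of_isLocalization (Submonoid.powers t₀) (Localization.Away t₀) Fi
  -- the model over `B`: localise the model `⟨P, e⟩` over `𝓞 Fᵢ` along `𝓞 Fᵢ → B → Fᵢ`
  let 𝒳 : IntegralModel (𝓞 Fi) Fi ((baseChange F Fi).obj X) := ⟨P, e⟩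
  obtain ⟨hsep, hflat⟩ := hgood t₀ (dvd_refl t₀) (Localization.Away t₀)
  refine ⟨Localization.Away t₀, inferInstance, inferInstance, algBFi, towBFi, inferInstance, towFBFi, towFAB, hflatB, hfpB,
    𝒳.localiseAt (Localization.Away t₀), IsFractionRing.injective (Localization.Away t₀) Fi, ?_, ?_, ?_, ?_, ?_⟩
  · exact inferInstanceAs (QuasiCompact (pullback.snd P.hom (Spec.map (CommRingCat.ofHom (algebraMap (𝓞 Fi) (Localization.Away t₀))))))
  · exact inferInstanceAs (QuasiSeparated (pullback.snd P.hom (Spec.map (CommRingCat.ofHom (algebraMap (𝓞 Fi) (Localization.Away t₀))))))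
  · exact hsep
  · exact hflat
  · exact inferInstanceAs
      (LocallyOfFinitePresentation (pullback.snd P.hom (Spec.map (CommRingCat.ofHom (algebraMap (𝓞 Fi) (Localization.Away t₀))))))

end Literature.AlgebraicGeometry.Limits

end
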